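import Literature.Topology.FourManifolds.ClosedBallExtension
import Literature.Topology.FourManifolds.EmbeddingBoundaryInvariance
import Literature.Topology.FourManifolds.Diffeotopy
import HarnessLib

/-!
# Families of smooth maps on the closed ball `𝔻ⁿ⁺¹`: extension with a parameter, restriction, boundary loops

Topic `Literature/Topology/FourManifolds`. Bridges between the manifold-with-boundary structure of
the closed unit ball `𝔻ⁿ⁺¹ ⊆ ℝⁿ⁺¹` (`ClosedBall.lean`, model `𝓡∂ (n + 1)`) and plain calculus in
`ℝⁿ⁺¹`, **with a finite-dimensional parameter** — the form needed to read *diffeotopies* of `𝔻ⁿ⁺¹`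
(tracks on `ℝ × 𝔻ⁿ⁺¹`, `Diffeotopy.lean`) in ambient coordinates and back (Cerf, LNM 53 (1968),
Ch. I §2 and Appendice §2, Proposition 1, in `CerfAppendixPropositionOne.lean`):

* `exists_contDiff_extension_of_contMDiff_prod_closedBall` — **Seeley's theorem with a
  parameter**: a map `G : P × 𝔻ⁿ⁺¹ → F`, `C^∞` for the product of `𝓘(ℝ, P)` with the
  structure with boundary, is the restriction of a `C^∞` map `g : P × ℝⁿ⁺¹ → F` (local
  extensions across `P × 𝕊ⁿ` by the tree's local form of Seeley's theorem
  `Literature.Analysis.Calculus.Seeley.exists_contDiffOn_extension` in the product of the boundary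
  chart with `P`, glued by a partition of unity — the proof of `ClosedBallExtension.lean` with `P`
  carried along);
* `contMDiff_prod_closedBall_mk` — conversely the restriction to `P × 𝔻ⁿ⁺¹` of an ambient `C^∞`
  map `P × ℝⁿ⁺¹ → ℝᵐ⁺¹` with values in `𝔻ᵐ⁺¹` is `C^∞` into the manifold with boundary;
* `norm_eq_one_of_norm_eq_one` — **invariance of the boundary**: a homeomorphism of `𝔻ⁿ⁺¹` maps
  the unit sphere to itself (`EmbeddingBoundaryInvariance.lean` + `boundary_closedBall`), and
  `norm_lt_one_of_norm_lt_one` — hence the open ball to itself;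
* `Diffeotopy.exists_boundaryLoop` — **the boundary family of a diffeotopy of `𝔻ⁿ⁺¹` is a
  diffeotopy of `𝕊ⁿ`**: for `D : Diffeotopy (𝓡∂ (n + 1)) 𝔻ⁿ⁺¹` the stages restricted to the unit
  sphere form a `Diffeotopy (𝓡 n) 𝕊ⁿ`;
* `Diffeotopy.ofAmbient` — a jointly `C^∞` pair of mutually inverse families of self-maps of
  `ℝⁿ⁺¹` preserving `𝔻ⁿ⁺¹`, starting at the identity, restricts to a `Diffeotopy (𝓡∂ (n + 1)) 𝔻ⁿ⁺¹`;
  and `Diffeotopy.exists_ambient` — every diffeotopy of `𝔻ⁿ⁺¹` arises this way on `𝔻ⁿ⁺¹` (its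
  stages and inverse stages are restrictions of jointly `C^∞` ambient families).

Everything is proved; there are no new notions and no named facts.

## References

* R. T. Seeley, *Extension of `C^∞` functions defined in a half space*, Proc. Amer. Math. Soc. 15
  (1964) 625–626. [Seeley1964]
* J. M. Lee, *Introduction to Smooth Manifolds*, 2nd ed., GTM 218 (2013), Lemma 2.26, Problem 1-11,
  Thm. 5.11. [LeeSmoothManifolds2013]
* J. Cerf, *Sur les difféomorphismes de la sphère de dimension trois (Γ₄ = 0)*, LNM 53 (1968),
  Ch. I §2; Appendice §2, Proposition 1. [CerfDiffeoSphere1968]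
-/

open scoped Manifold ContDiff Topology
open Set Function Metric

noncomputable section

namespace Literature.Topology.FourManifolds

attribute [local instance] fact_finrank_euclideanSpace_succ

variable {n : ℕ}

/-! ### Seeley's theorem with a parameter -/

section Extension

variable {P : Type*} [NormedAddCommGroup P] [NormedSpace ℝ P] [FiniteDimensional ℝ P]

omit [FiniteDimensional ℝ P] in
/-- The chart `refl × (boundary chart at q)` of `P × 𝔻ⁿ⁺¹` lies in the maximal atlas. [folklore] -/
theorem refl_prod_closedBallBoundaryChart_mem_maximalAtlas
    (q : Metric.sphere (0 : EuclideanSpace ℝ (Fin (n + 1))) 1) :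
    (OpenPartialHomeomorph.refl P).prod (closedBallBoundaryChart q) ∈
      IsManifold.maximalAtlas (𝓘(ℝ, P).prod (𝓡∂ (n + 1))) ∞
        (P × Metric.closedBall (0 : EuclideanSpace ℝ (Fin (n + 1))) 1) := by
  refine IsManifold.subset_maximalAtlas (mem_image2_of_mem ?_ (mem_insert_of_mem _ (mem_range_self q)))
  rw [chartedSpaceSelf_atlas]

omit [FiniteDimensional ℝ P] in
/-- The chart `refl × (interior chart)` of `P × 𝔻ⁿ⁺¹` lies in the maximal atlas. [folklore] -/
theorem refl_prod_closedBallInteriorChart_mem_maximalAtlas :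
    (OpenPartialHomeomorph.refl P).prod (closedBallInteriorChart n) ∈
      IsManifold.maximalAtlas (𝓘(ℝ, P).prod (𝓡∂ (n + 1))) ∞
        (P × Metric.closedBall (0 : EuclideanSpace ℝ (Fin (n + 1))) 1) := by
  refine IsManifold.subset_maximalAtlas (mem_image2_of_mem ?_ (mem_insert _ _))
  rw [chartedSpaceSelf_atlas]

/-- **Local extension across `P × 𝕊ⁿ`** (Seeley's theorem in the product of `P` with the polar
chart): a `C^∞` map `G` on `P × 𝔻ⁿ⁺¹` agrees, on a neighbourhood `U` of `(p₀, q)` in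
`P × ℝⁿ⁺¹` (`q ∈ 𝕊ⁿ`), with a map `g` which is `C^∞` on `U`. [cite: Seeley1964, Theorem] -/
theorem exists_contDiffOn_extension_nhds_sphere_family {F : Type*} [NormedAddCommGroup F]
    [NormedSpace ℝ F] [CompleteSpace F]
    (G : P × Metric.closedBall (0 : EuclideanSpace ℝ (Fin (n + 1))) 1 → F)
    (hG : ContMDiff (𝓘(ℝ, P).prod (𝓡∂ (n + 1))) 𝓘(ℝ, F) ∞ G) (p₀ : P)
    (q : Metric.sphere (0 : EuclideanSpace ℝ (Fin (n + 1))) 1) :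
    ∃ U : Set (P × EuclideanSpace ℝ (Fin (n + 1))), IsOpen U ∧
      (p₀, (q : EuclideanSpace ℝ (Fin (n + 1)))) ∈ U ∧
      ∃ g : P × EuclideanSpace ℝ (Fin (n + 1)) → F, ContDiffOn ℝ ∞ g U ∧
        ∀ (p : P) (y : EuclideanSpace ℝ (Fin (n + 1)))
          (hy : y ∈ Metric.closedBall (0 : EuclideanSpace ℝ (Fin (n + 1))) 1),
          (p, y) ∈ U → g (p, y) = G (p, ⟨y, hy⟩) := by
  set e := closedBallBoundaryChart q with he_def
  set ee := (OpenPartialHomeomorph.refl P).prod e with hee_def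
  have hee : ee ∈ IsManifold.maximalAtlas (𝓘(ℝ, P).prod (𝓡∂ (n + 1))) ∞
      (P × Metric.closedBall (0 : EuclideanSpace ℝ (Fin (n + 1))) 1) :=
    refl_prod_closedBallBoundaryChart_mem_maximalAtlas q
  -- `G` read through the product chart
  have hf : ContMDiffOn 𝓘(ℝ, P × EuclideanSpace ℝ (Fin (n + 1))) 𝓘(ℝ, F) ∞
      (G ∘ (ee.extend (𝓘(ℝ, P).prod (𝓡∂ (n + 1)))).symm)
      ((𝓘(ℝ, P).prod (𝓡∂ (n + 1))) '' ee.target) :=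
    hG.comp_contMDiffOn (contMDiffOn_extend_symm hee)
  have htgt : (𝓘(ℝ, P).prod (𝓡∂ (n + 1))) '' ee.target =
      (univ : Set P) ×ˢ ({w : EuclideanSpace ℝ (Fin (n + 1)) | w 0 < 1} ∩ {w | 0 ≤ w 0}) := by
    ext ⟨p, w⟩
    constructor
    · rintro ⟨⟨p', z⟩, hz, h⟩
      rw [hee_def, OpenPartialHomeomorph.prod_target] at hz
      simp only [modelWithCorners_prod_coe, Prod.map, Prod.mk.injEq] at h
      obtain ⟨rfl, rfl⟩ := h
      exact ⟨mem_univ _, hz.2, z.2⟩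
    · rintro ⟨-, h1, h0⟩
      refine ⟨(p, ⟨w, h0⟩), ?_, rfl⟩
      rw [hee_def, OpenPartialHomeomorph.prod_target]
      exact ⟨mem_univ _, h1⟩
  rw [contMDiffOn_iff_contDiffOn, htgt] at hf
  -- coordinates: `L z = (z 0, tail z)` on `ℝⁿ⁺¹`, `Λ (p, z) = (z 0, (p, tail z))`
  set L : EuclideanSpace ℝ (Fin (n + 1)) ≃L[ℝ] ℝ × EuclideanSpace ℝ (Fin n) :=
    ((sphereInclusionComplementEquiv n).symm.trans
      (LinearEquiv.prodComm ℝ (EuclideanSpace ℝ (Fin n)) ℝ)).toContinuousLinearEquiv with hL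
  have hL1 : ∀ z, (L z).1 = z 0 := fun z => rfl
  have hL2 : ∀ r, L.symm r 0 = r.1 := fun r => rfl
  set Λₗ : (P × EuclideanSpace ℝ (Fin (n + 1))) ≃ₗ[ℝ] ℝ × (P × EuclideanSpace ℝ (Fin n)) :=
    { toFun := fun r => ((L r.2).1, (r.1, (L r.2).2))
      invFun := fun s => (s.2.1, L.symm (s.1, s.2.2))
      map_add' := fun r r' => by simp
      map_smul' := fun c r => by simp
      left_inv := fun r => by simp
      right_inv := fun s => by simp } with hΛₗ
  set Λ : (P × EuclideanSpace ℝ (Fin (n + 1))) ≃L[ℝ] ℝ × (P × EuclideanSpace ℝ (Fin n)) :=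
    Λₗ.toContinuousLinearEquiv with hΛ
  have hΛ1 : ∀ r, (Λ r).1 = r.2 0 := fun r => rfl
  have hΛs : ∀ s, (Λ.symm s).2 0 = s.1 := fun s => hL2 _
  have hΛs1 : ∀ s, (Λ.symm s).1 = s.2.1 := fun s => rfl
  set f' : ℝ × (P × EuclideanSpace ℝ (Fin n)) → F :=
    (G ∘ (ee.extend (𝓘(ℝ, P).prod (𝓡∂ (n + 1)))).symm) ∘ Λ.symm with hf'_def
  have hf' : ContDiffOn ℝ ∞ f' ({s : ℝ × (P × EuclideanSpace ℝ (Fin n)) | s.1 < 1} ∩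
      {s | 0 ≤ s.1}) := by
    refine hf.comp Λ.symm.contDiff.contDiffOn ?_
    intro s hs
    refine ⟨mem_univ _, ?_, ?_⟩
    · show (Λ.symm s).2 0 < 1
      rw [hΛs]; exact hs.1
    · show 0 ≤ (Λ.symm s).2 0
      rw [hΛs]; exact hs.2
  -- Seeley's theorem at the chart value of `(p₀, q)`
  set x₀ : P × EuclideanSpace ℝ (Fin n) := (Λ (p₀, polarChart q q)).2 with hx₀
  have hq0 : ∀ p : P, (Λ (p, polarChart q q)).1 = 0 := by
    intro p
    rw [hΛ1, polarChart_apply]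
    simp
  have hΛq : Λ (p₀, polarChart q q) = ((0 : ℝ), x₀) := Prod.ext (hq0 p₀) rfl
  have hUo : IsOpen {s : ℝ × (P × EuclideanSpace ℝ (Fin n)) | s.1 < 1} :=
    isOpen_lt continuous_fst continuous_const
  obtain ⟨V, hVo, hV0, -, g', hg', hg'f⟩ :=
    Literature.Analysis.Calculus.Seeley.exists_contDiffOn_extension (x₀ := x₀) hUo
      (show (0 : ℝ) < 1 from one_pos) hf'
  -- pull back by `(p, y) ↦ Λ (p, polarChart q y)`
  set φ : P × EuclideanSpace ℝ (Fin (n + 1)) → ℝ × (P × EuclideanSpace ℝ (Fin n)) :=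
    fun r => Λ (r.1, polarChart q r.2) with hφ
  set S₀ : Set (P × EuclideanSpace ℝ (Fin (n + 1))) := (univ : Set P) ×ˢ (polarChart q).source
    with hS₀
  have hS₀o : IsOpen S₀ := isOpen_univ.prod (polarChart q).open_source
  have hφc : ContDiffOn ℝ ∞ φ S₀ := by
    refine Λ.contDiff.comp_contDiffOn (contDiffOn_fst.prodMk ?_)
    exact (contDiffOn_polarChart q).comp contDiffOn_snd fun r hr => hr.2
  refine ⟨S₀ ∩ φ ⁻¹' V, hφc.continuousOn.isOpen_inter_preimage hS₀o hVo,
    ⟨⟨mem_univ _, mem_polarChart_source_self q⟩, ?_⟩, g' ∘ φ, ?_, ?_⟩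
  · show Λ (p₀, polarChart q q) ∈ V
    rwa [hΛq]
  · exact hg'.comp (hφc.mono inter_subset_left) fun r hr => hr.2
  · intro p y hy hyU
    have h1 : ee.extend (𝓘(ℝ, P).prod (𝓡∂ (n + 1))) (p, ⟨y, hy⟩) = (p, polarChart q y) := rfl
    have h2 : 0 ≤ (Λ (p, polarChart q y)).1 := by
      rw [hΛ1, polarChart_apply]
      simpa using mem_closedBall_zero_iff.1 hy
    have h3 : ((p, ⟨y, hy⟩) : P × Metric.closedBall (0 : EuclideanSpace ℝ (Fin (n + 1))) 1) ∈
        ee.source := by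
      rw [hee_def, OpenPartialHomeomorph.prod_source]
      exact ⟨mem_univ _, (mem_closedBallBoundaryChart_source_iff q _).2 hyU.1.2⟩
    show g' (Λ (p, polarChart q y)) = G (p, ⟨y, hy⟩)
    rw [hg'f ⟨hyU.2, h2⟩]
    show G ((ee.extend (𝓘(ℝ, P).prod (𝓡∂ (n + 1)))).symm (Λ.symm (Λ (p, polarChart q y)))) = _
    rw [Λ.symm_apply_apply, ← h1, ee.extend_left_inv h3]

omit [FiniteDimensional ℝ P] in
/-- **Local extension on `P × 𝔹`**: a `C^∞` map `G` on `P × 𝔻ⁿ⁺¹` agrees on `P × 𝔹` with a map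
`g` which is `C^∞` there (`G` read through `refl × (interior chart)`). [folklore] -/
theorem exists_contDiffOn_extension_ball_family {F : Type*} [NormedAddCommGroup F] [NormedSpace ℝ F]
    (G : P × Metric.closedBall (0 : EuclideanSpace ℝ (Fin (n + 1))) 1 → F)
    (hG : ContMDiff (𝓘(ℝ, P).prod (𝓡∂ (n + 1))) 𝓘(ℝ, F) ∞ G) :
    ∃ g : P × EuclideanSpace ℝ (Fin (n + 1)) → F,
      ContDiffOn ℝ ∞ g ((univ : Set P) ×ˢ ball (0 : EuclideanSpace ℝ (Fin (n + 1))) 1) ∧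
      ∀ (p : P) (y : EuclideanSpace ℝ (Fin (n + 1)))
        (hy : y ∈ Metric.closedBall (0 : EuclideanSpace ℝ (Fin (n + 1))) 1), ‖y‖ < 1 →
        g (p, y) = G (p, ⟨y, hy⟩) := by
  set e := closedBallInteriorChart n with he_def
  set ee := (OpenPartialHomeomorph.refl P).prod e with hee_def
  have hee : ee ∈ IsManifold.maximalAtlas (𝓘(ℝ, P).prod (𝓡∂ (n + 1))) ∞
      (P × Metric.closedBall (0 : EuclideanSpace ℝ (Fin (n + 1))) 1) :=
    refl_prod_closedBallInteriorChart_mem_maximalAtlas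
  have hf : ContMDiffOn 𝓘(ℝ, P × EuclideanSpace ℝ (Fin (n + 1))) 𝓘(ℝ, F) ∞
      (G ∘ (ee.extend (𝓘(ℝ, P).prod (𝓡∂ (n + 1)))).symm)
      ((𝓘(ℝ, P).prod (𝓡∂ (n + 1))) '' ee.target) :=
    hG.comp_contMDiffOn (contMDiffOn_extend_symm hee)
  rw [contMDiffOn_iff_contDiffOn] at hf
  refine ⟨fun r => (G ∘ (ee.extend (𝓘(ℝ, P).prod (𝓡∂ (n + 1)))).symm)
    (r.1, r.2 + (2 : ℝ) • closedBallBaseVector n), ?_, ?_⟩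
  · refine hf.comp (contDiff_fst.prodMk (contDiff_snd.add contDiff_const)).contDiffOn ?_
    rintro ⟨p, y⟩ ⟨-, hy⟩
    have hy1 : ‖y‖ ≤ 1 := (mem_ball_zero_iff.1 hy).le
    refine ⟨(p, ⟨y + (2 : ℝ) • closedBallBaseVector n,
      zero_le_one.trans (one_le_coe_add_two_smul_apply n ⟨y, mem_closedBall_zero_iff.2 hy1⟩)⟩),
      ⟨mem_univ _, ?_⟩, rfl⟩
    show ‖y + (2 : ℝ) • closedBallBaseVector n - (2 : ℝ) • closedBallBaseVector n‖ < 1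
    simpa using hy
  · intro p y hy hy1
    have h1 : ee.extend (𝓘(ℝ, P).prod (𝓡∂ (n + 1))) (p, ⟨y, hy⟩) =
        (p, y + (2 : ℝ) • closedBallBaseVector n) := rfl
    have h3 : ((p, ⟨y, hy⟩) : P × Metric.closedBall (0 : EuclideanSpace ℝ (Fin (n + 1))) 1) ∈
        ee.source := by
      rw [hee_def, OpenPartialHomeomorph.prod_source]
      exact ⟨mem_univ _, show ‖y‖ < 1 from hy1⟩
    show G ((ee.extend (𝓘(ℝ, P).prod (𝓡∂ (n + 1)))).symm
      (p, y + (2 : ℝ) • closedBallBaseVector n)) = G (p, ⟨y, hy⟩)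
    rw [← h1, ee.extend_left_inv h3]

/-- **Seeley's theorem with a parameter: `C^∞` maps on `P × 𝔻ⁿ⁺¹` extend to `P × ℝⁿ⁺¹`.** If
`G : P × 𝔻ⁿ⁺¹ → F` is `C^∞` for the product of `𝓘(ℝ, P)` with the manifold-with-boundary
structure of `𝔻ⁿ⁺¹` (`P` a finite-dimensional real normed space, `F` complete), there is a `C^∞`
map `g : P × ℝⁿ⁺¹ → F` with `g (p, x) = G (p, x)` for `x ∈ 𝔻ⁿ⁺¹` (local extensions glued by a
partition of unity, as in Lee's Extension Lemma 2.26). [cite: Seeley1964, Theorem] -/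
theorem exists_contDiff_extension_of_contMDiff_prod_closedBall {F : Type*} [NormedAddCommGroup F]
    [NormedSpace ℝ F] [CompleteSpace F]
    (G : P × Metric.closedBall (0 : EuclideanSpace ℝ (Fin (n + 1))) 1 → F)
    (hG : ContMDiff (𝓘(ℝ, P).prod (𝓡∂ (n + 1))) 𝓘(ℝ, F) ∞ G) :
    ∃ g : P × EuclideanSpace ℝ (Fin (n + 1)) → F, ContDiff ℝ ∞ g ∧
      ∀ (p : P) (x : Metric.closedBall (0 : EuclideanSpace ℝ (Fin (n + 1))) 1),
        g (p, x) = G (p, x) := by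
  let t : P × EuclideanSpace ℝ (Fin (n + 1)) → Set F := fun r =>
    {v | ∀ hy : r.2 ∈ Metric.closedBall (0 : EuclideanSpace ℝ (Fin (n + 1))) 1,
      v = G (r.1, ⟨r.2, hy⟩)}
  have ht : ∀ r, Convex ℝ (t r) := by
    intro r
    by_cases hy : r.2 ∈ Metric.closedBall (0 : EuclideanSpace ℝ (Fin (n + 1))) 1
    · have : t r = {G (r.1, ⟨r.2, hy⟩)} := by
        ext v
        simp only [t, mem_setOf_eq, mem_singleton_iff]
        exact ⟨fun h => h hy, fun h _ => h⟩
      rw [this]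
      exact convex_singleton _
    · have : t r = univ := eq_univ_of_forall fun v h => absurd h hy
      rw [this]
      exact convex_univ
  have Hloc : ∀ r : P × EuclideanSpace ℝ (Fin (n + 1)), ∃ U ∈ 𝓝 r,
      ∃ g : P × EuclideanSpace ℝ (Fin (n + 1)) → F,
        ContMDiffOn 𝓘(ℝ, P × EuclideanSpace ℝ (Fin (n + 1))) 𝓘(ℝ, F) ∞ g U ∧
          ∀ y ∈ U, g y ∈ t y := by
    rintro ⟨p, x⟩
    rcases lt_trichotomy ‖x‖ 1 with hx | hx | hx
    · obtain ⟨g, hg, hgG⟩ := exists_contDiffOn_extension_ball_family G hG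
      refine ⟨(univ : Set P) ×ˢ ball (0 : EuclideanSpace ℝ (Fin (n + 1))) 1,
        (isOpen_univ.prod isOpen_ball).mem_nhds ⟨mem_univ _, mem_ball_zero_iff.2 hx⟩, g,
        contMDiffOn_iff_contDiffOn.2 hg, ?_⟩
      rintro ⟨p', y⟩ ⟨-, hy⟩ hy'
      exact hgG p' y hy' (mem_ball_zero_iff.1 hy)
    · obtain ⟨U, hUo, hxU, g, hg, hgG⟩ := exists_contDiffOn_extension_nhds_sphere_family G hG p
        ⟨x, mem_sphere_zero_iff_norm.2 hx⟩
      refine ⟨U, hUo.mem_nhds hxU, g, contMDiffOn_iff_contDiffOn.2 hg, ?_⟩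
      rintro ⟨p', y⟩ hy hy'
      exact hgG p' y hy' hy
    · refine ⟨{r | 1 < ‖r.2‖}, (isOpen_lt continuous_const (continuous_norm.comp continuous_snd)).mem_nhds hx,
        0, contMDiffOn_const, ?_⟩
      rintro ⟨p', y⟩ hy hy'
      exact absurd (mem_closedBall_zero_iff.1 hy') (not_le.2 hy)
  obtain ⟨g, hg⟩ := exists_contMDiffMap_forall_mem_convex_of_local
    𝓘(ℝ, P × EuclideanSpace ℝ (Fin (n + 1))) ht Hloc
  exact ⟨g, contMDiff_iff_contDiff.1 g.contMDiff, fun p x => hg (p, (x : EuclideanSpace ℝ (Fin (n + 1)))) x.2⟩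

omit [FiniteDimensional ℝ P] in
/-- **Restriction of an ambient smooth family to `P × 𝔻ⁿ⁺¹`.** If `g : P × ℝⁿ⁺¹ → ℝᵐ⁺¹` is `C^∞`
and maps `P × 𝔻ⁿ⁺¹` into `𝔻ᵐ⁺¹`, the induced map `P × 𝔻ⁿ⁺¹ → 𝔻ᵐ⁺¹` is `C^∞` for the structures
with boundary. [folklore] -/
theorem contMDiff_prod_closedBall_mk {m : ℕ}
    {g : P × EuclideanSpace ℝ (Fin (n + 1)) → EuclideanSpace ℝ (Fin (m + 1))} (hg : ContDiff ℝ ∞ g)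
    (h : ∀ (p : P) (x : Metric.closedBall (0 : EuclideanSpace ℝ (Fin (n + 1))) 1),
      g (p, x) ∈ Metric.closedBall (0 : EuclideanSpace ℝ (Fin (m + 1))) 1) :
    ContMDiff (𝓘(ℝ, P).prod (𝓡∂ (n + 1))) (𝓡∂ (m + 1)) ∞
      (fun r : P × Metric.closedBall (0 : EuclideanSpace ℝ (Fin (n + 1))) 1 =>
        (⟨g (r.1, r.2), h r.1 r.2⟩ : Metric.closedBall (0 : EuclideanSpace ℝ (Fin (m + 1))) 1)) := by
  have h1 : ContMDiff (𝓘(ℝ, P).prod (𝓡∂ (n + 1))) 𝓘(ℝ, P × EuclideanSpace ℝ (Fin (n + 1))) ∞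
      (fun r : P × Metric.closedBall (0 : EuclideanSpace ℝ (Fin (n + 1))) 1 =>
        (r.1, (r.2 : EuclideanSpace ℝ (Fin (n + 1))))) :=
    contMDiff_fst.prodMk_space (contMDiff_coe_closedBall.comp contMDiff_snd)
  have h2 : ContMDiff (𝓘(ℝ, P).prod (𝓡∂ (n + 1))) 𝓘(ℝ, EuclideanSpace ℝ (Fin (m + 1))) ∞
      (fun r : P × Metric.closedBall (0 : EuclideanSpace ℝ (Fin (n + 1))) 1 =>
        g (r.1, (r.2 : EuclideanSpace ℝ (Fin (n + 1))))) :=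
    hg.contMDiff.comp h1
  exact h2.codRestrict_closedBall fun r => h r.1 r.2

end Extension

/-! ### Invariance of the boundary sphere under homeomorphisms of the closed ball -/

/-- **A homeomorphism of `𝔻ⁿ⁺¹` maps the unit sphere into itself** (invariance of the boundary:
`EmbeddingBoundaryInvariance.lean`, applied to the embedding `𝔻ⁿ⁺¹ ≅ 𝔻ⁿ⁺¹ ↪ ℝⁿ⁺¹`; if `‖G x‖ < 1`
the closed ball is a neighbourhood of `G x`, so `x` is an interior point, i.e. `‖x‖ < 1` by
`boundary_closedBall`). [cite: HatcherAT2002, Thm. 2B.3 and the remark following it] -/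
theorem norm_eq_one_of_norm_eq_one
    (G : Metric.closedBall (0 : EuclideanSpace ℝ (Fin (n + 1))) 1 ≃ₜ
      Metric.closedBall (0 : EuclideanSpace ℝ (Fin (n + 1))) 1)
    {x : Metric.closedBall (0 : EuclideanSpace ℝ (Fin (n + 1))) 1}
    (hx : ‖(x : EuclideanSpace ℝ (Fin (n + 1)))‖ = 1) :
    ‖(G x : EuclideanSpace ℝ (Fin (n + 1)))‖ = 1 := by
  by_contra hne
  have hlt : ‖(G x : EuclideanSpace ℝ (Fin (n + 1)))‖ < 1 :=
    lt_of_le_of_ne (mem_closedBall_zero_iff.1 (G x).2) hne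
  have hemb : Topology.IsEmbedding
      ((Subtype.val : Metric.closedBall (0 : EuclideanSpace ℝ (Fin (n + 1))) 1 →
        EuclideanSpace ℝ (Fin (n + 1))) ∘ G) :=
    Topology.IsEmbedding.subtypeVal.comp G.isEmbedding
  have hrange : range ((Subtype.val : Metric.closedBall (0 : EuclideanSpace ℝ (Fin (n + 1))) 1 →
      EuclideanSpace ℝ (Fin (n + 1))) ∘ G) = Metric.closedBall 0 1 := by
    rw [range_comp, G.surjective.range_eq, image_univ, Subtype.range_coe]
  have hnhds : range ((Subtype.val : Metric.closedBall (0 : EuclideanSpace ℝ (Fin (n + 1))) 1 →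
      EuclideanSpace ℝ (Fin (n + 1))) ∘ G) ∈ 𝓝 (((Subtype.val ∘ G) x)) := by
    rw [hrange]
    exact Filter.mem_of_superset (isOpen_ball.mem_nhds (mem_ball_zero_iff.2 hlt)) ball_subset_closedBall
  have hint := isInteriorPoint_of_range_mem_nhds (n := n) hemb hnhds
  have hbd : x ∈ (𝓡∂ (n + 1)).boundary (Metric.closedBall (0 : EuclideanSpace ℝ (Fin (n + 1))) 1) := by
    rw [boundary_closedBall]
    exact hx
  exact (ModelWithCorners.isBoundaryPoint_iff_not_isInteriorPoint _).1 hbd hint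

/-- **A homeomorphism of `𝔻ⁿ⁺¹` maps the open ball into itself** (apply
`norm_eq_one_of_norm_eq_one` to the inverse). [folklore] -/
theorem norm_lt_one_of_norm_lt_one
    (G : Metric.closedBall (0 : EuclideanSpace ℝ (Fin (n + 1))) 1 ≃ₜ
      Metric.closedBall (0 : EuclideanSpace ℝ (Fin (n + 1))) 1)
    {x : Metric.closedBall (0 : EuclideanSpace ℝ (Fin (n + 1))) 1}
    (hx : ‖(x : EuclideanSpace ℝ (Fin (n + 1)))‖ < 1) :
    ‖(G x : EuclideanSpace ℝ (Fin (n + 1)))‖ < 1 := by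
  refine lt_of_le_of_ne (mem_closedBall_zero_iff.1 (G x).2) fun h1 => ?_
  have := norm_eq_one_of_norm_eq_one G.symm (x := G x) h1
  rw [G.symm_apply_apply] at this
  exact hx.ne this

/-! ### Diffeotopies of the closed ball: boundary loops and ambient coordinates -/

namespace Diffeotopy

/-- The stages of a diffeotopy of `𝔻ⁿ⁺¹` preserve the unit sphere. [folklore] -/
theorem norm_toFun_eq_one
    (D : Diffeotopy (𝓡∂ (n + 1)) (Metric.closedBall (0 : EuclideanSpace ℝ (Fin (n + 1))) 1))
    (t : ℝ) {x : Metric.closedBall (0 : EuclideanSpace ℝ (Fin (n + 1))) 1}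
    (hx : ‖(x : EuclideanSpace ℝ (Fin (n + 1)))‖ = 1) :
    ‖(D.toFun t x : EuclideanSpace ℝ (Fin (n + 1)))‖ = 1 :=
  norm_eq_one_of_norm_eq_one (D.stage t).toHomeomorph hx

/-- The inverse stages of a diffeotopy of `𝔻ⁿ⁺¹` preserve the unit sphere. [folklore] -/
theorem norm_invFun_eq_one
    (D : Diffeotopy (𝓡∂ (n + 1)) (Metric.closedBall (0 : EuclideanSpace ℝ (Fin (n + 1))) 1))
    (t : ℝ) {x : Metric.closedBall (0 : EuclideanSpace ℝ (Fin (n + 1))) 1}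
    (hx : ‖(x : EuclideanSpace ℝ (Fin (n + 1)))‖ = 1) :
    ‖(D.invFun t x : EuclideanSpace ℝ (Fin (n + 1)))‖ = 1 :=
  norm_eq_one_of_norm_eq_one (D.stage t).toHomeomorph.symm hx

/-- The stages of a diffeotopy of `𝔻ⁿ⁺¹` preserve the open ball. [folklore] -/
theorem norm_toFun_lt_one
    (D : Diffeotopy (𝓡∂ (n + 1)) (Metric.closedBall (0 : EuclideanSpace ℝ (Fin (n + 1))) 1))
    (t : ℝ) {x : Metric.closedBall (0 : EuclideanSpace ℝ (Fin (n + 1))) 1}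
    (hx : ‖(x : EuclideanSpace ℝ (Fin (n + 1)))‖ < 1) :
    ‖(D.toFun t x : EuclideanSpace ℝ (Fin (n + 1)))‖ < 1 :=
  norm_lt_one_of_norm_lt_one (D.stage t).toHomeomorph hx

/-- The inverse stages of a diffeotopy of `𝔻ⁿ⁺¹` preserve the open ball. [folklore] -/
theorem norm_invFun_lt_one
    (D : Diffeotopy (𝓡∂ (n + 1)) (Metric.closedBall (0 : EuclideanSpace ℝ (Fin (n + 1))) 1))
    (t : ℝ) {x : Metric.closedBall (0 : EuclideanSpace ℝ (Fin (n + 1))) 1}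
    (hx : ‖(x : EuclideanSpace ℝ (Fin (n + 1)))‖ < 1) :
    ‖(D.invFun t x : EuclideanSpace ℝ (Fin (n + 1)))‖ < 1 :=
  norm_lt_one_of_norm_lt_one (D.stage t).toHomeomorph.symm hx

/-- **The boundary loop of a diffeotopy of the closed ball.** For a diffeotopy `D` of `𝔻ⁿ⁺¹`
(model with boundary) the restrictions of its stages to the unit sphere are the stages of a
diffeotopy `∂D` of `𝕊ⁿ`: `(∂D)_t z = D_t z`. (The restriction is `C^∞` as a map into `ℝⁿ⁺¹`,
through the smooth inclusions `𝕊ⁿ ↪ 𝔻ⁿ⁺¹ ↪ ℝⁿ⁺¹`, and takes values in `𝕊ⁿ` by invariance of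
the boundary, so it is `C^∞` into `𝕊ⁿ` by `ContMDiff.codRestrict_sphere`.) Cerf (1968), Ch. I
§2: the restriction map `Diff D³ → Diff S²` applied to a path. [cite: CerfDiffeoSphere1968, Ch. I §2] -/
theorem exists_boundaryLoop
    (D : Diffeotopy (𝓡∂ (n + 1)) (Metric.closedBall (0 : EuclideanSpace ℝ (Fin (n + 1))) 1)) :
    ∃ B : Diffeotopy (𝓡 n) (Metric.sphere (0 : EuclideanSpace ℝ (Fin (n + 1))) 1),
      (∀ (t : ℝ) (z : Metric.sphere (0 : EuclideanSpace ℝ (Fin (n + 1))) 1),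
        ((B.toFun t z : Metric.sphere (0 : EuclideanSpace ℝ (Fin (n + 1))) 1) :
          EuclideanSpace ℝ (Fin (n + 1))) =
          (D.toFun t ⟨z, sphere_subset_closedBall z.2⟩ : EuclideanSpace ℝ (Fin (n + 1)))) ∧
      (∀ (t : ℝ) (z : Metric.sphere (0 : EuclideanSpace ℝ (Fin (n + 1))) 1),
        ((B.invFun t z : Metric.sphere (0 : EuclideanSpace ℝ (Fin (n + 1))) 1) :
          EuclideanSpace ℝ (Fin (n + 1))) =
          (D.invFun t ⟨z, sphere_subset_closedBall z.2⟩ : EuclideanSpace ℝ (Fin (n + 1)))) := by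
  -- the two families as maps into `ℝⁿ⁺¹`
  set f : ℝ × Metric.sphere (0 : EuclideanSpace ℝ (Fin (n + 1))) 1 → EuclideanSpace ℝ (Fin (n + 1)) :=
    fun r => (D.toFun r.1 ⟨r.2, sphere_subset_closedBall r.2.2⟩ : EuclideanSpace ℝ (Fin (n + 1)))
    with hf
  set g : ℝ × Metric.sphere (0 : EuclideanSpace ℝ (Fin (n + 1))) 1 → EuclideanSpace ℝ (Fin (n + 1)) :=
    fun r => (D.invFun r.1 ⟨r.2, sphere_subset_closedBall r.2.2⟩ : EuclideanSpace ℝ (Fin (n + 1)))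
    with hg
  -- the inclusion `ℝ × 𝕊ⁿ → ℝ × 𝔻ⁿ⁺¹` is smooth
  have hincl : ContMDiff (𝓡 n) (𝓡∂ (n + 1)) ∞
      (fun z : Metric.sphere (0 : EuclideanSpace ℝ (Fin (n + 1))) 1 =>
        (⟨z, sphere_subset_closedBall z.2⟩ : Metric.closedBall (0 : EuclideanSpace ℝ (Fin (n + 1))) 1)) :=
    (contMDiff_coe_sphere (E := EuclideanSpace ℝ (Fin (n + 1))) (n := n)).codRestrict_closedBall
      fun z => sphere_subset_closedBall z.2
  have hι : ContMDiff (𝓘(ℝ, ℝ).prod (𝓡 n)) (𝓘(ℝ, ℝ).prod (𝓡∂ (n + 1))) ∞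
      (fun r : ℝ × Metric.sphere (0 : EuclideanSpace ℝ (Fin (n + 1))) 1 =>
        (r.1, (⟨r.2, sphere_subset_closedBall r.2.2⟩ :
          Metric.closedBall (0 : EuclideanSpace ℝ (Fin (n + 1))) 1))) :=
    contMDiff_fst.prodMk (hincl.comp contMDiff_snd)
  have hfs : ContMDiff (𝓘(ℝ, ℝ).prod (𝓡 n)) 𝓘(ℝ, EuclideanSpace ℝ (Fin (n + 1))) ∞ f :=
    contMDiff_coe_closedBall.comp (D.contMDiff_uncurry_toFun.comp hι)
  have hgs : ContMDiff (𝓘(ℝ, ℝ).prod (𝓡 n)) 𝓘(ℝ, EuclideanSpace ℝ (Fin (n + 1))) ∞ g :=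
    contMDiff_coe_closedBall.comp (D.contMDiff_uncurry_invFun.comp hι)
  have hf1 : ∀ r, f r ∈ Metric.sphere (0 : EuclideanSpace ℝ (Fin (n + 1))) 1 := fun r =>
    mem_sphere_zero_iff_norm.2 (D.norm_toFun_eq_one r.1 (mem_sphere_zero_iff_norm.1 r.2.2))
  have hg1 : ∀ r, g r ∈ Metric.sphere (0 : EuclideanSpace ℝ (Fin (n + 1))) 1 := fun r =>
    mem_sphere_zero_iff_norm.2 (D.norm_invFun_eq_one r.1 (mem_sphere_zero_iff_norm.1 r.2.2))
  set F : ℝ → Metric.sphere (0 : EuclideanSpace ℝ (Fin (n + 1))) 1 →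
      Metric.sphere (0 : EuclideanSpace ℝ (Fin (n + 1))) 1 := fun t z => ⟨f (t, z), hf1 (t, z)⟩
    with hF
  set G : ℝ → Metric.sphere (0 : EuclideanSpace ℝ (Fin (n + 1))) 1 →
      Metric.sphere (0 : EuclideanSpace ℝ (Fin (n + 1))) 1 := fun t z => ⟨g (t, z), hg1 (t, z)⟩
    with hG
  have hFs : ContMDiff (𝓘(ℝ, ℝ).prod (𝓡 n)) (𝓡 n) ∞ (uncurry F) :=
    hfs.codRestrict_sphere hf1
  have hGs : ContMDiff (𝓘(ℝ, ℝ).prod (𝓡 n)) (𝓡 n) ∞ (uncurry G) :=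
    hgs.codRestrict_sphere hg1
  have hGF : ∀ t z, G t (F t z) = z := by
    intro t z
    apply Subtype.ext
    show (D.invFun t ⟨(D.toFun t ⟨z, _⟩ : EuclideanSpace ℝ (Fin (n + 1))), _⟩ :
      EuclideanSpace ℝ (Fin (n + 1))) = z
    have : (⟨(D.toFun t ⟨z, sphere_subset_closedBall z.2⟩ : EuclideanSpace ℝ (Fin (n + 1))),
        sphere_subset_closedBall (hf1 (t, z))⟩ :
        Metric.closedBall (0 : EuclideanSpace ℝ (Fin (n + 1))) 1) =
        D.toFun t ⟨z, sphere_subset_closedBall z.2⟩ := Subtype.ext rfl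
    rw [this, D.invFun_toFun]
  have hFG : ∀ t z, F t (G t z) = z := by
    intro t z
    apply Subtype.ext
    show (D.toFun t ⟨(D.invFun t ⟨z, _⟩ : EuclideanSpace ℝ (Fin (n + 1))), _⟩ :
      EuclideanSpace ℝ (Fin (n + 1))) = z
    have : (⟨(D.invFun t ⟨z, sphere_subset_closedBall z.2⟩ : EuclideanSpace ℝ (Fin (n + 1))),
        sphere_subset_closedBall (hg1 (t, z))⟩ :
        Metric.closedBall (0 : EuclideanSpace ℝ (Fin (n + 1))) 1) =
        D.invFun t ⟨z, sphere_subset_closedBall z.2⟩ := Subtype.ext rfl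
    rw [this, D.toFun_invFun]
  have h0 : F 0 = id := by
    funext z
    apply Subtype.ext
    show (D.toFun 0 ⟨z, _⟩ : EuclideanSpace ℝ (Fin (n + 1))) = z
    rw [D.toFun_zero]
    rfl
  exact ⟨Diffeotopy.mk' (𝓡 n) F G hFs hGs hGF hFG h0, fun t z => rfl, fun t z => rfl⟩

/-- **Diffeotopies of `𝔻ⁿ⁺¹` from ambient families.** Jointly `C^∞`, mutually inverse families
`k_t`, `k'_t` of self-maps of `ℝⁿ⁺¹` which preserve the closed unit ball, with `k_0 = id`,
restrict to a diffeotopy of `𝔻ⁿ⁺¹` (manifold with boundary) with stages `k_t|𝔻ⁿ⁺¹`.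
[folklore] -/
theorem exists_ofAmbient {k k' : ℝ × EuclideanSpace ℝ (Fin (n + 1)) → EuclideanSpace ℝ (Fin (n + 1))}
    (hk : ContDiff ℝ ∞ k) (hk' : ContDiff ℝ ∞ k')
    (hkD : ∀ (t : ℝ) (x : Metric.closedBall (0 : EuclideanSpace ℝ (Fin (n + 1))) 1),
      k (t, x) ∈ Metric.closedBall (0 : EuclideanSpace ℝ (Fin (n + 1))) 1)
    (hk'D : ∀ (t : ℝ) (x : Metric.closedBall (0 : EuclideanSpace ℝ (Fin (n + 1))) 1),
      k' (t, x) ∈ Metric.closedBall (0 : EuclideanSpace ℝ (Fin (n + 1))) 1)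
    (hk'k : ∀ (t : ℝ) (x : Metric.closedBall (0 : EuclideanSpace ℝ (Fin (n + 1))) 1),
      k' (t, k (t, x)) = x)
    (hkk' : ∀ (t : ℝ) (x : Metric.closedBall (0 : EuclideanSpace ℝ (Fin (n + 1))) 1),
      k (t, k' (t, x)) = x)
    (hk0 : ∀ x : Metric.closedBall (0 : EuclideanSpace ℝ (Fin (n + 1))) 1, k (0, x) = x) :
    ∃ D : Diffeotopy (𝓡∂ (n + 1)) (Metric.closedBall (0 : EuclideanSpace ℝ (Fin (n + 1))) 1),
      (∀ (t : ℝ) (x : Metric.closedBall (0 : EuclideanSpace ℝ (Fin (n + 1))) 1),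
        (D.toFun t x : EuclideanSpace ℝ (Fin (n + 1))) = k (t, x)) ∧
      (∀ (t : ℝ) (x : Metric.closedBall (0 : EuclideanSpace ℝ (Fin (n + 1))) 1),
        (D.invFun t x : EuclideanSpace ℝ (Fin (n + 1))) = k' (t, x)) := by
  set F : ℝ → Metric.closedBall (0 : EuclideanSpace ℝ (Fin (n + 1))) 1 →
      Metric.closedBall (0 : EuclideanSpace ℝ (Fin (n + 1))) 1 := fun t x => ⟨k (t, x), hkD t x⟩
    with hF
  set G : ℝ → Metric.closedBall (0 : EuclideanSpace ℝ (Fin (n + 1))) 1 →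
      Metric.closedBall (0 : EuclideanSpace ℝ (Fin (n + 1))) 1 := fun t x => ⟨k' (t, x), hk'D t x⟩
    with hG
  have hFs : ContMDiff (𝓘(ℝ, ℝ).prod (𝓡∂ (n + 1))) (𝓡∂ (n + 1)) ∞ (uncurry F) :=
    contMDiff_prod_closedBall_mk hk hkD
  have hGs : ContMDiff (𝓘(ℝ, ℝ).prod (𝓡∂ (n + 1))) (𝓡∂ (n + 1)) ∞ (uncurry G) :=
    contMDiff_prod_closedBall_mk hk' hk'D
  have hGF : ∀ t x, G t (F t x) = x := fun t x => Subtype.ext (hk'k t x)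
  have hFG : ∀ t x, F t (G t x) = x := fun t x => Subtype.ext (hkk' t x)
  have h0 : F 0 = id := funext fun x => Subtype.ext (hk0 x)
  exact ⟨Diffeotopy.mk' (𝓡∂ (n + 1)) F G hFs hGs hGF hFG h0, fun t x => rfl, fun t x => rfl⟩

/-- **Ambient coordinates for a diffeotopy of `𝔻ⁿ⁺¹`** (Seeley's theorem with the time
parameter): the stages and the inverse stages of a diffeotopy `D` of `𝔻ⁿ⁺¹` are the restrictions
of jointly `C^∞` maps `d, e : ℝ × ℝⁿ⁺¹ → ℝⁿ⁺¹`. [cite: Seeley1964, Theorem] -/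
theorem exists_ambient
    (D : Diffeotopy (𝓡∂ (n + 1)) (Metric.closedBall (0 : EuclideanSpace ℝ (Fin (n + 1))) 1)) :
    ∃ d e : ℝ × EuclideanSpace ℝ (Fin (n + 1)) → EuclideanSpace ℝ (Fin (n + 1)),
      ContDiff ℝ ∞ d ∧ ContDiff ℝ ∞ e ∧
      (∀ (t : ℝ) (x : Metric.closedBall (0 : EuclideanSpace ℝ (Fin (n + 1))) 1),
        d (t, x) = D.toFun t x) ∧
      (∀ (t : ℝ) (x : Metric.closedBall (0 : EuclideanSpace ℝ (Fin (n + 1))) 1),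
        e (t, x) = D.invFun t x) := by
  obtain ⟨d, hd, hdD⟩ := exists_contDiff_extension_of_contMDiff_prod_closedBall
    (fun r : ℝ × Metric.closedBall (0 : EuclideanSpace ℝ (Fin (n + 1))) 1 =>
      (D.toFun r.1 r.2 : EuclideanSpace ℝ (Fin (n + 1))))
    (contMDiff_coe_closedBall.comp D.contMDiff_uncurry_toFun)
  obtain ⟨e, he, heD⟩ := exists_contDiff_extension_of_contMDiff_prod_closedBall
    (fun r : ℝ × Metric.closedBall (0 : EuclideanSpace ℝ (Fin (n + 1))) 1 =>
      (D.invFun r.1 r.2 : EuclideanSpace ℝ (Fin (n + 1))))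
    (contMDiff_coe_closedBall.comp D.contMDiff_uncurry_invFun)
  exact ⟨d, e, hd, he, fun t x => hdD t x, fun t x => heD t x⟩

end Diffeotopy

end Literature.Topology.FourManifolds
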